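import Literature.NumberTheory.Automorphic.ArthurClozelBaseChangeProofs
import Literature.NumberTheory.Automorphic.AutomorphicGaloisConjBaseChange
import Literature.NumberTheory.Automorphic.AdelicGroupDataUniquenessProofs
import HarnessLib

/-!
# Arthur–Clozel, Ch. 3, Thm. 4.2 (a)–(b): assembly from the existence clause (proof file)

Topic `NumberTheory/Automorphic`; namespace `Literature.NumberTheory.Automorphic`. Sibling proof
file of `ArthurClozelBaseChange` / `ArthurClozelBaseChangeProofs` (statements of Arthur–Clozel,
*Simple algebras, base change, and the advanced theory of the trace formula*, Ann. of Math.
Stud. 120 (1989), Ch. 3, Thm. 4.2 with the class-field character `η`) and of `Sweep1Proofs` (the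
`η`-free dichotomy `ArthurClozel1989_exists_cuspidal_weakLift_or_dvd` behind lang.S23).
Everything here is **proved**; no new named fact is introduced.

The *existence and cuspidality clause* of Thm. 4.2 (a) — `π` cuspidal on `GL_n(𝔸_F)`, `n ≥ 1`,
`π ≇ π ⊗ η` ⇒ some *cuspidal* `Π` on `GL_n(𝔸_E)` lifting `π` (Def. 1.1) — is the part of (a) that
Arthur–Clozel obtain from the comparison (4.1) = (4.2) of the discrete parts of the trace formula
for `GL_n(𝔸_F)` and of the `σ`-twisted trace formula for `GL_n(𝔸_E)` (op. cit. Ch. 2, (17.8);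
Ch. 3, §4, pp. 203–205 of the printed book: Thm. 3.1, Lemma 4.3, Jacquet–Shalika (2.1)–(2.4),
and Thm. 4.2 (d), (e) inductively in `n`). It is **not** a separate named fact of the tree (it is
the whole trace-formula content of (a), with the same locator; the named fact for Thm. 4.2 (a) is
`ArthurClozel1989_weakLifting_cuspidal` of `ArthurClozelBaseChange`, whose proved projection
`ArthurClozel1989_weakLifting_cuspidal.exists_cuspidal_weakLift` is the clause): below it appears
as an explicit hypothesis `hex`, spelled out with exactly the binders of
`ArthurClozel1989_weakLifting_cuspidal`, in the theorems recording what follows from the clause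
alone:

* `arthurClozel1989_weakLifting_cuspidal_of_exists` — **Thm. 4.2 (a) in full from its existence
  clause and strong multiplicity one over `E`**: the remaining clauses of (a) are "obvious by
  (2.4)" (op. cit. p. 205): a cuspidal weak lift is unique (`IsWeakBaseChangeLift.unique`,
  `UnramifiedHeckeLevel`) and hence `σ`-stable (`isGalStable_of_isWeakBaseChangeLift_cuspidal`,
  `AutomorphicGaloisConjBaseChange`), the `Gal(E/F)`-invariance of the automorphic measure `ν`
  being the theorem `isGalInvariant_of_unique` fed with the proved uniqueness of automorphic
  measures `isAutomorphicMeasure_unique_smul_holds` (`AdelicGroupDataUniquenessProofs`);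
  `arthurClozel1989_weakLifting_cuspidal_iff_exists` records the equivalence of (a) with its
  clause granted `strong_multiplicity_one_gl` over `E` (used in rank one by
  `Sweep1BaseChangeGLOneAssembly`, where both inputs are theorems).
* `arthurClozel1989_exists_cuspidal_weakLift_or_dvd_of_exists_weakLift_of_twist_ne` — **the
  dichotomy `ArthurClozel1989_exists_cuspidal_weakLift_or_dvd` ("cuspidal weak lift, or `ℓ ∣ n`")
  from the existence clause, class field theory (`exists_isClassFieldCharacter`) and multiplicity
  one over `F` (`multiplicity_one_gl`) only**: for `π` cuspidal either `π ⊗ η ≠ π` and the clause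
  yields a cuspidal weak lift, or `π ⊗ η = π` and `ℓ = ord(η) ∣ n` by the theorem
  `arthurClozel1989_dvd_of_twist_eq_of_classField` (Thm. 4.2 (b), clause `ℓ ∣ n`, proved in
  `ArthurClozelBaseChangeProofs`); `n = 0` is trivial. This sharpens
  `arthurClozel1989_exists_cuspidal_weakLift_or_dvd_of_weakLifting` (which assumed (a) in full)
  and pins the trust base of the dichotomy — hence of lang.S23 for `ℓ ∤ n`
  (`exists_cuspidal_baseChange_of_not_dvd_of_exists_weakLift_of_twist_ne`, through the proved
  equivalence of `Sweep1BaseChangeProofs`) — to the clause and these two named facts; no strong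
  multiplicity one over `E` (hence no uniqueness or `σ`-stability of the lift) is needed for it.

## References

* J. Arthur, L. Clozel, *Simple algebras, base change, and the advanced theory of the trace
  formula*, Ann. of Math. Stud. 120 (1989), Ch. 3, §4, Thm. 4.2 (a), (b) and the proof of (a),
  pp. 203–205 ("the uniqueness of `Π` is obvious by (2.4)"). [ArthurClozelAMS120]
* J. W. S. Cassels, A. Fröhlich (eds.), *Algebraic Number Theory* (1967), Ch. VII (Tate), §5.1
  Main Theorem (B). [CasselsFrohlichANT1967]
-/

noncomputable section

namespace Literature.NumberTheory.Automorphic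

open NumberField IsDedekindDomain _root_.MeasureTheory Filter AdelicGroupData

section Assembly

variable {n : ℕ} {F E : Type} [Field F] [NumberField F] [Field E] [NumberField E] [Algebra F E]
  [FiniteDimensional F E]

/-- **Arthur–Clozel, Ch. 3, Thm. 4.2 (a) from its existence clause.** Granted strong multiplicity
one over `E` (`strong_multiplicity_one_gl`, Jacquet–Shalika (2.4) with multiplicity one), the
existence-and-cuspidality clause of Thm. 4.2 (a) — the hypothesis `hex`: for `E/F` Galois of prime
degree `ℓ` with class-field character `η` and `π` cuspidal on `GL_n(𝔸_F)`, `n ≥ 1`, with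
`π ⊗ η ≠ π` (under `multiplicity_one_gl` the printed `π ≇ π ⊗ η`), some
`L²_cusp(GL_n(𝔸_E) ⧸ A_G GL_n(E), ν)`, `ν` automorphic, contains a cuspidal weak lift of `π`; the
binders are those of `ArthurClozel1989_weakLifting_cuspidal` — implies the full rendering
`ArthurClozel1989_weakLifting_cuspidal`: the cuspidal weak lift `Π` of `π` provided by the clause
lives in an `L²_cusp(GL_n(𝔸_E) ⧸ A_G GL_n(E), ν)` whose automorphic measure `ν` is
`Gal(E/F)`-invariant (`isGalInvariant_of_unique`, by the uniqueness of automorphic measures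
`isAutomorphicMeasure_unique_smul_holds`), it is the unique cuspidal weak lift of `π` there
(`IsWeakBaseChangeLift.unique`: "the uniqueness of `Π` is obvious by (2.4)", op. cit. p. 205) and
therefore `σ`-stable for every `σ` (`isGalStable_of_isWeakBaseChangeLift_cuspidal`: `U_σ(Π)` is
again a cuspidal weak lift of `π`). The converse projection is
`ArthurClozel1989_weakLifting_cuspidal.exists_cuspidal_weakLift` (`ArthurClozelBaseChange`).
[cite: ArthurClozelAMS120, Ch. 3, Thm. 4.2 (a) and its proof, §4 (p. 205)] -/
theorem arthurClozel1989_weakLifting_cuspidal_of_exists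
    (hex : ∀ [IsGalois F E] (_hn : 0 < n) (_hℓ : (Module.finrank F E).Prime)
      (η : Literature.NumberTheory.GaloisRepresentations.HeckeCharacter F)
      (hη : η.IsClassFieldCharacter E)
      (μ : Measure (gl n F).automorphicQuotient) [(gl n F).IsAutomorphicMeasure μ]
      (_hm : multiplicity_one_gl n F μ) (P : CuspidalAutomorphicRepGL n F μ)
      (_hP : P.twistByFiniteOrderChar η hη.isFiniteOrder ≠ P),
      ∃ (ν : Measure (gl n E).automorphicQuotient) (_ : (gl n E).IsAutomorphicMeasure ν)
        (Q : CuspidalAutomorphicRepGL n E ν), IsWeakBaseChangeLift P.1 Q.1)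
    (hSMO : ∀ (ν : Measure (gl n E).automorphicQuotient) [(gl n E).IsAutomorphicMeasure ν],
      strong_multiplicity_one_gl (n := n) (K := E) (μ := ν)) :
    ArthurClozel1989_weakLifting_cuspidal n F E := by
  intro _ hn hℓ η hη μ _ hm P hP
  obtain ⟨ν, hνA, Q, hQ⟩ := hex hn hℓ η hη μ hm P hP
  haveI := hνA
  have hν : IsGalInvariant F ν :=
    isGalInvariant_of_unique F (isAutomorphicMeasure_unique_smul_holds n E) ν
  obtain ⟨𝔫, -, h𝔫⟩ := exists_hasSatakeParameterAt_cofinite_holds (n := n) (K := F) (μ := μ) P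
  exact ⟨ν, hνA, hν, Q, hQ,
    fun σ => isGalStable_of_isWeakBaseChangeLift_cuspidal (hSMO ν) P hQ hν σ,
    fun Q' hQ' =>
      IsWeakBaseChangeLift.unique (hSMO ν) exists_hasSatakeParameterAt_cofinite_holds h𝔫 hQ' hQ⟩

/-- **Thm. 4.2 (a) is equivalent to its existence-and-cuspidality clause, granted strong
multiplicity one over `E`**: forget uniqueness and `σ`-stability
(`ArthurClozel1989_weakLifting_cuspidal.exists_cuspidal_weakLift`), or recover them "by (2.4)"
(`arthurClozel1989_weakLifting_cuspidal_of_exists`). The right-hand side is the clause, with the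
binders of `ArthurClozel1989_weakLifting_cuspidal`. [cite: ArthurClozelAMS120, Ch. 3, Thm. 4.2 (a)] -/
theorem arthurClozel1989_weakLifting_cuspidal_iff_exists
    (hSMO : ∀ (ν : Measure (gl n E).automorphicQuotient) [(gl n E).IsAutomorphicMeasure ν],
      strong_multiplicity_one_gl (n := n) (K := E) (μ := ν)) :
    ArthurClozel1989_weakLifting_cuspidal n F E ↔
      ∀ [IsGalois F E] (_hn : 0 < n) (_hℓ : (Module.finrank F E).Prime)
        (η : Literature.NumberTheory.GaloisRepresentations.HeckeCharacter F)
        (hη : η.IsClassFieldCharacter E)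
        (μ : Measure (gl n F).automorphicQuotient) [(gl n F).IsAutomorphicMeasure μ]
        (_hm : multiplicity_one_gl n F μ) (P : CuspidalAutomorphicRepGL n F μ)
        (_hP : P.twistByFiniteOrderChar η hη.isFiniteOrder ≠ P),
        ∃ (ν : Measure (gl n E).automorphicQuotient) (_ : (gl n E).IsAutomorphicMeasure ν)
          (Q : CuspidalAutomorphicRepGL n E ν), IsWeakBaseChangeLift P.1 Q.1 :=
  ⟨ArthurClozel1989_weakLifting_cuspidal.exists_cuspidal_weakLift,
    fun hex => arthurClozel1989_weakLifting_cuspidal_of_exists hex hSMO⟩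

/-- **The dichotomy `ArthurClozel1989_exists_cuspidal_weakLift_or_dvd` of `Sweep1Proofs` from the
existence clause of Thm. 4.2 (a), class field theory and multiplicity one over `F` only.** For
`E/F` Galois of prime degree `ℓ` (hence cyclic) and `π` cuspidal on `GL_n(𝔸_F)`: if `n = 0` then
`ℓ ∣ 0`; otherwise let `η` be a class-field character (`exists_isClassFieldCharacter`); if
`π ⊗ η = π` then `ℓ = ord(η) ∣ n` (Thm. 4.2 (b), clause `ℓ ∣ n`, the theorem
`arthurClozel1989_dvd_of_twist_eq_of_classField`); if `π ⊗ η ≠ π` (under `multiplicity_one_gl`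
the printed `π ≇ π ⊗ η`) the existence clause (the hypothesis `hex`, binders of
`ArthurClozel1989_weakLifting_cuspidal`) gives a cuspidal weak lift. Uniqueness and `σ`-stability
of the lift (the rest of (a)) and strong multiplicity one over `E` are not needed; with (a) in
full this is `arthurClozel1989_exists_cuspidal_weakLift_or_dvd_of_weakLifting`
(`ArthurClozelBaseChangeProofs`). [cite: ArthurClozelAMS120, Ch. 3, Thm. 4.2 (a)–(b)] -/
theorem arthurClozel1989_exists_cuspidal_weakLift_or_dvd_of_exists_weakLift_of_twist_ne
    (hCFT : exists_isClassFieldCharacter (F := F) (E := E))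
    (hex : ∀ [IsGalois F E] (_hn : 0 < n) (_hℓ : (Module.finrank F E).Prime)
      (η : Literature.NumberTheory.GaloisRepresentations.HeckeCharacter F)
      (hη : η.IsClassFieldCharacter E)
      (μ : Measure (gl n F).automorphicQuotient) [(gl n F).IsAutomorphicMeasure μ]
      (_hm : multiplicity_one_gl n F μ) (P : CuspidalAutomorphicRepGL n F μ)
      (_hP : P.twistByFiniteOrderChar η hη.isFiniteOrder ≠ P),
      ∃ (ν : Measure (gl n E).automorphicQuotient) (_ : (gl n E).IsAutomorphicMeasure ν)
        (Q : CuspidalAutomorphicRepGL n E ν), IsWeakBaseChangeLift P.1 Q.1)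
    (hm : ∀ (μ : Measure (gl n F).automorphicQuotient) [(gl n F).IsAutomorphicMeasure μ],
      multiplicity_one_gl n F μ) :
    ArthurClozel1989_exists_cuspidal_weakLift_or_dvd (n := n) (F := F) (E := E) := by
  intro _ hℓ μ _ P
  rcases Nat.eq_zero_or_pos n with hn | hn
  · exact Or.inr (hn ▸ dvd_zero _)
  haveI : Fact (Module.finrank F E).Prime := ⟨hℓ⟩
  haveI : IsCyclic (E ≃ₐ[F] E) := isCyclic_of_prime_card (IsGalois.card_aut_eq_finrank F E)
  obtain ⟨η, hη, -⟩ := hCFT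
  by_cases hP : P.twistByFiniteOrderChar η hη.isFiniteOrder = P
  · exact Or.inr (arthurClozel1989_dvd_of_twist_eq_of_classField hCFT hn hℓ η hη μ P hP)
  · obtain ⟨ν, hνA, Q, hQ⟩ := hex hn hℓ η hη μ (hm μ) P hP
    exact Or.inl ⟨ν, hνA, Q, hQ⟩

/-- **lang.S23 (`ℓ ∤ n`) from the existence clause of Thm. 4.2 (a), class field theory and
multiplicity one over `F`.** The Langlands-list statement `exists_cuspidal_baseChange_of_not_dvd`
(`Sweep1`) follows from the existence-and-cuspidality clause of Thm. 4.2 (a) (the hypothesis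
`hex`, binders of `ArthurClozel1989_weakLifting_cuspidal`), `exists_isClassFieldCharacter` and
`multiplicity_one_gl` over `F`, through the dichotomy
(`arthurClozel1989_exists_cuspidal_weakLift_or_dvd_of_exists_weakLift_of_twist_ne`) and
`exists_cuspidal_baseChange_of_not_dvd_of_arthurClozel` (`Sweep1BaseChangeProofs`); with (a) in
full this is `exists_cuspidal_baseChange_of_not_dvd_of_weakLifting` (`ArthurClozelBaseChangeProofs`).
[cite: ArthurClozelAMS120, Ch. 3, Thm. 4.2 (a)] -/
theorem exists_cuspidal_baseChange_of_not_dvd_of_exists_weakLift_of_twist_ne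
    (hCFT : exists_isClassFieldCharacter (F := F) (E := E))
    (hex : ∀ [IsGalois F E] (_hn : 0 < n) (_hℓ : (Module.finrank F E).Prime)
      (η : Literature.NumberTheory.GaloisRepresentations.HeckeCharacter F)
      (hη : η.IsClassFieldCharacter E)
      (μ : Measure (gl n F).automorphicQuotient) [(gl n F).IsAutomorphicMeasure μ]
      (_hm : multiplicity_one_gl n F μ) (P : CuspidalAutomorphicRepGL n F μ)
      (_hP : P.twistByFiniteOrderChar η hη.isFiniteOrder ≠ P),
      ∃ (ν : Measure (gl n E).automorphicQuotient) (_ : (gl n E).IsAutomorphicMeasure ν)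
        (Q : CuspidalAutomorphicRepGL n E ν), IsWeakBaseChangeLift P.1 Q.1)
    (hm : ∀ (μ : Measure (gl n F).automorphicQuotient) [(gl n F).IsAutomorphicMeasure μ],
      multiplicity_one_gl n F μ) :
    exists_cuspidal_baseChange_of_not_dvd (n := n) (F := F) (E := E) :=
  exists_cuspidal_baseChange_of_not_dvd_of_arthurClozel
    (arthurClozel1989_exists_cuspidal_weakLift_or_dvd_of_exists_weakLift_of_twist_ne hCFT hex hm)

/-- **lang.S23 (`ℓ ∤ n`) from the existence clause, for one fixed `n` with `ℓ ∤ n`, without (b).**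
When `ℓ ∤ n`, class field theory enters only through the existence of a class-field character
`η` and multiplicity one over `F`: `π ⊗ η = π` is impossible for cuspidal `π` on `GL_n(𝔸_F)`,
`n ≥ 1`, since it forces `ord(η) ∣ n` (`orderOf_dvd_of_twistByFiniteOrderChar_eq`) while
`ord(η) = ℓ` (`IsClassFieldCharacter.orderOf_eq_finrank`); so the existence clause of Thm. 4.2 (a)
(the hypothesis `hex`, binders of `ArthurClozel1989_weakLifting_cuspidal`) applies to every
cuspidal `π`, giving a cuspidal weak lift. [cite: ArthurClozelAMS120, Ch. 3, Thm. 4.2 (a)] -/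
theorem exists_cuspidal_weakLift_of_exists_weakLift_of_twist_ne_of_not_dvd
    (hCFT : exists_isClassFieldCharacter (F := F) (E := E))
    (hex : ∀ [IsGalois F E] (_hn : 0 < n) (_hℓ : (Module.finrank F E).Prime)
      (η : Literature.NumberTheory.GaloisRepresentations.HeckeCharacter F)
      (hη : η.IsClassFieldCharacter E)
      (μ : Measure (gl n F).automorphicQuotient) [(gl n F).IsAutomorphicMeasure μ]
      (_hm : multiplicity_one_gl n F μ) (P : CuspidalAutomorphicRepGL n F μ)
      (_hP : P.twistByFiniteOrderChar η hη.isFiniteOrder ≠ P),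
      ∃ (ν : Measure (gl n E).automorphicQuotient) (_ : (gl n E).IsAutomorphicMeasure ν)
        (Q : CuspidalAutomorphicRepGL n E ν), IsWeakBaseChangeLift P.1 Q.1)
    [IsGalois F E] (hℓ : (Module.finrank F E).Prime) (hnd : ¬ Module.finrank F E ∣ n)
    (μ : Measure (gl n F).automorphicQuotient) [(gl n F).IsAutomorphicMeasure μ]
    (hm : multiplicity_one_gl n F μ) (P : CuspidalAutomorphicRepGL n F μ) :
    ∃ (ν : Measure (gl n E).automorphicQuotient) (_ : (gl n E).IsAutomorphicMeasure ν)
      (Q : CuspidalAutomorphicRepGL n E ν), IsWeakBaseChangeLift P.1 Q.1 := by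
  have hn : 0 < n := Nat.pos_of_ne_zero fun h => hnd (h ▸ dvd_zero _)
  haveI : Fact (Module.finrank F E).Prime := ⟨hℓ⟩
  haveI : IsCyclic (E ≃ₐ[F] E) := isCyclic_of_prime_card (IsGalois.card_aut_eq_finrank F E)
  obtain ⟨η, hη, -⟩ := hCFT
  have hP : P.twistByFiniteOrderChar η hη.isFiniteOrder ≠ P := fun hP =>
    hnd (arthurClozel1989_dvd_of_twist_eq_of_classField hCFT hn hℓ η hη μ P hP)
  exact hex hn hℓ η hη μ hm P hP

end Assembly

end Literature.NumberTheory.Automorphic
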